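import Literature.NumberTheory.EllipticCurves.ZpExtensionEisensteinDVRSetting
import Literature.NumberTheory.GaloisCohomology.Howard2004.LevelQuotientProofs
import Mathlib.NumberTheory.Padics.PadicVal.Basic
import HarnessLib

/-!
# Kolyvagin primes of an Eisenstein tower have `p`-depth: `λ ∈ 𝓛_s(T) ⇒ p^s ∣ ℓ + 1`; `LargePrimes` for the
# curve's `DVRSetting` (proofs file)

Topic `NumberTheory/EllipticCurves` (D1 road of cell `pub/bsd-print-x9`; companion of `ZpExtensionEisensteinDVRSetting`).
THEOREMS ONLY; no definition, no named fact, no instance, no notation, no `sorry`.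

Howard, Def. 1.2.1 and §1.6 [arXiv:1202.6340 p. 6 L63–68, p. 11 L15–16]: `𝓛_s(T) = {ℓ ∈ 𝓛₀ : I_ℓ ⊂ p^s R}` and Thm. 1.6.1
assumes «`𝓛_s(T) ⊂ 𝓛` for `s ≫ 0`» (`DVRSetting.LargePrimes`).  Over Howard's DVR `S_m = Λ/(T^m + p)` (uniformiser `π`,
`p = −π^m`, `natCast_eq_neg_mk_X_pow_quotient_X_pow_add_C`) the valuation of a natural number `n` is `m·v_p(n)`, so:
* `IwasawaAlgebra.isUnit_natCast_quotient_X_pow_add_C_of_not_dvd` — `p ∤ u ⇒ u ∈ S_mˣ`;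
* **`IwasawaAlgebra.pow_dvd_of_natCast_mem_span_pow_quotient_X_pow_add_C`** — `(n : S_m) ∈ (p^s) ⇒ p^s ∣ n` (`n ≠ 0`);
* **`Howard2004.AdicTower.pow_dvd_residueChar_add_one_of_mem_kolyvaginPrimes`** — for any tower over `S_m`:
  `λ ∈ 𝓛_s(T) ⇒ p^s ∣ ℓ + 1`;
* `Howard2004.AdicTower.exists_forall_not_mem_of_mem_kolyvaginPrimes` — a FINITE set of places misses `𝓛_s(T)` for
  `s ≫ 0` (`ℓ + 1 ≠ 0` has bounded `p`-valuation on the finite set);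
* **`WeierstrassCurve.eisensteinDVRSetting_largePrimes`** — `LargePrimes` for the curve's Eisenstein setting whenever the
  chosen `𝓛` contains `𝓛_{s₁}(T) ∖ S` for some `s₁` (with `𝓛_s ⊂ 𝓛_{s₁}` for `s ≥ s₁`, `AdicTower.kolyvaginPrimes_antitone`).
So the caller may take `𝓛 := 𝓛_{s₁}(T) ∖ S`: `𝓛 ⊂ 𝓛₀(T)` by definition, `𝓛 ∩ S = ∅` by construction, and `LargePrimes` by this
file.  The `LargePrimes` statement carries the CONSUMER PREAMBLE of `ZpExtensionEisensteinDVRSetting`.  BSD is not proved.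

References: [Howard2004HeegnerKolyvagin] Def. 1.2.1, §1.6 (arXiv p. 6 L63–68, p. 11 L13–16), proof of Thm. 2.2.10;
[Washington1997] §13.2; [SerreLocalFields1979] I §6.
-/

set_option autoImplicit false

noncomputable section

open Function NumberField IsDedekindDomain Field
open scoped NumberField ContRepresentation TensorProduct Classical

namespace Literature.NumberTheory.EllipticCurves.IwasawaAlgebra

variable (p : ℕ) [hp : Fact p.Prime]

/-- A natural number prime to `p` is a UNIT of `S_m = Λ/(T^m + p)` (it is a unit of `ℤ_p ⊂ S_m`).
[cite: Washington1997, §13.2] [cite: SerreLocalFields1979, I §6] -/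
theorem isUnit_natCast_quotient_X_pow_add_C_of_not_dvd (m : ℕ) {u : ℕ} (hu : ¬ p ∣ u) :
    IsUnit ((u : ℕ) : (IwasawaAlgebra p ⧸ Ideal.span {(PowerSeries.X ^ m + PowerSeries.C (p : ℤ_[p]) : IwasawaAlgebra p)})) := by
  have h1 : IsUnit ((u : ℕ) : ℤ_[p]) := by
    rw [PadicInt.isUnit_iff]
    refine le_antisymm (PadicInt.norm_le_one _) (not_lt.mp fun hlt ↦ hu ?_)
    rw [← Int.cast_natCast, PadicInt.norm_int_lt_one_iff_dvd] at hlt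
    exact_mod_cast hlt
  simpa only [map_natCast] using h1.map (algebraMap ℤ_[p] (IwasawaAlgebra p ⧸ Ideal.span {(PowerSeries.X ^ m + PowerSeries.C (p : ℤ_[p]) : IwasawaAlgebra p)}))

/-- **`(n : S_m) ∈ (p^s) ⇒ p^s ∣ n`** for `n ≠ 0` (`m ≥ 1`): in the DVR `S_m` with uniformiser `π`, `p = −π^m`, so the
valuation of `n = p^v·u` (`p ∤ u`) is `m·v` and that of `p^s` is `m·s`; `p^s ∣ n` in `S_m` forces `m·s ≤ m·v`.
[cite: Howard2004HeegnerKolyvagin, Def. 1.2.1 (I_ℓ ⊂ p^s R) and proof of Thm. 2.2.10 (𝔮 = T^m + p)] [cite: SerreLocalFields1979, I §6] -/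
theorem pow_dvd_of_natCast_mem_span_pow_quotient_X_pow_add_C {m : ℕ} (hm : 1 ≤ m) {n : ℕ} (hn : n ≠ 0) {s : ℕ}
    (h : ((n : ℕ) : (IwasawaAlgebra p ⧸ Ideal.span {(PowerSeries.X ^ m + PowerSeries.C (p : ℤ_[p]) : IwasawaAlgebra p)})) ∈ Ideal.span {((p : ℕ) : (IwasawaAlgebra p ⧸ Ideal.span {(PowerSeries.X ^ m + PowerSeries.C (p : ℤ_[p]) : IwasawaAlgebra p)})) ^ s}) : p ^ s ∣ n := by
  letI := isDomain_quotient_X_pow_add_C p hm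
  letI := isDiscreteValuationRing_quotient_X_pow_add_C p hm
  have hπ := irreducible_mk_X p hm
  have hp' := natCast_eq_neg_mk_X_pow_quotient_X_pow_add_C p m
  obtain ⟨v, u, hu, rfl⟩ := Nat.exists_eq_pow_mul_and_not_dvd hn p hp.out.ne_one
  obtain ⟨uu, huu⟩ := isUnit_natCast_quotient_X_pow_add_C_of_not_dvd p m hu
  -- valuations
  have hval_n : IsDiscreteValuationRing.addVal (IwasawaAlgebra p ⧸ Ideal.span {(PowerSeries.X ^ m + PowerSeries.C (p : ℤ_[p]) : IwasawaAlgebra p)}) ((p ^ v * u : ℕ) : (IwasawaAlgebra p ⧸ Ideal.span {(PowerSeries.X ^ m + PowerSeries.C (p : ℤ_[p]) : IwasawaAlgebra p)})) = (m * v : ℕ) := by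
    refine IsDiscreteValuationRing.addVal_def _ (uu * (-1) ^ v) hπ (m * v) ?_
    rw [Nat.cast_mul, Nat.cast_pow, hp', ← huu, Units.val_mul, Units.val_pow_eq_pow_val, Units.val_neg,
      Units.val_one, pow_mul, neg_pow]
    ring
  have hval_ps : IsDiscreteValuationRing.addVal (IwasawaAlgebra p ⧸ Ideal.span {(PowerSeries.X ^ m + PowerSeries.C (p : ℤ_[p]) : IwasawaAlgebra p)}) (((p : ℕ) : (IwasawaAlgebra p ⧸ Ideal.span {(PowerSeries.X ^ m + PowerSeries.C (p : ℤ_[p]) : IwasawaAlgebra p)})) ^ s) = (m * s : ℕ) := by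
    refine IsDiscreteValuationRing.addVal_def _ ((-1) ^ s) hπ (m * s) ?_
    rw [hp', Units.val_pow_eq_pow_val, Units.val_neg, Units.val_one, pow_mul]
    ring
  have hdvd : ((p : ℕ) : (IwasawaAlgebra p ⧸ Ideal.span {(PowerSeries.X ^ m + PowerSeries.C (p : ℤ_[p]) : IwasawaAlgebra p)})) ^ s ∣ ((p ^ v * u : ℕ) : (IwasawaAlgebra p ⧸ Ideal.span {(PowerSeries.X ^ m + PowerSeries.C (p : ℤ_[p]) : IwasawaAlgebra p)})) := Ideal.mem_span_singleton.mp h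
  have hle := IsDiscreteValuationRing.addVal_le_iff_dvd.mpr hdvd
  rw [hval_ps, hval_n, Nat.cast_le] at hle
  have hsv : s ≤ v := Nat.le_of_mul_le_mul_left hle (by omega)
  exact Dvd.dvd.mul_right (pow_dvd_pow p hsv) u

end Literature.NumberTheory.EllipticCurves.IwasawaAlgebra

namespace Literature.NumberTheory.GaloisCohomology.Howard2004.AdicTower

open Literature.NumberTheory.GaloisRepresentations Literature.NumberTheory.EllipticCurves

variable {K : Type} [Field K] [NumberField K] {p : ℕ} [hp : Fact p.Prime] {m : ℕ}
  {N : ℕ → Type} [∀ k, AddCommGroup (N k)] [∀ k, TopologicalSpace (N k)] [∀ k, DiscreteTopology (N k)]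
  [∀ k, Module (IwasawaAlgebra p ⧸ Ideal.span {(PowerSeries.X ^ m + PowerSeries.C (p : ℤ_[p]) : IwasawaAlgebra p)}) (N k)]

/-- **`λ ∈ 𝓛_s(T) ⇒ p^s ∣ ℓ + 1`** for ANY π-adic tower `T` over Howard's DVR `S_m = Λ/(T^m + p)` (the clause
«`ℓ + 1 ∈ p^s R`» of `𝓛_s`, read back in `ℕ`). [cite: Howard2004HeegnerKolyvagin, Def. 1.2.1 (arXiv p. 6, L63–68)] -/
theorem pow_dvd_residueChar_add_one_of_mem_kolyvaginPrimes (hm : 1 ≤ m)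
    (T : letI := IwasawaAlgebra.isLocalRing_quotient_X_pow_add_C p hm
      AdicTower K (IwasawaAlgebra p ⧸ Ideal.span {(PowerSeries.X ^ m + PowerSeries.C (p : ℤ_[p]) : IwasawaAlgebra p)}) N)
    {s : ℕ} {v : HeightOneSpectrum (𝓞 K)}
    (hv : letI := IwasawaAlgebra.isLocalRing_quotient_X_pow_add_C p hm
      v ∈ T.kolyvaginPrimes p s) :
    p ^ s ∣ residueChar v + 1 :=
  IwasawaAlgebra.pow_dvd_of_natCast_mem_span_pow_quotient_X_pow_add_C p hm (Nat.succ_ne_zero _) hv.2.1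

/-- **A finite set of places misses `𝓛_s(T)` for `s ≫ 0`** (`T` over `S_m`): for `λ ∈ S ∩ 𝓛_s(T)`, `p^s ∣ ℓ + 1 ≠ 0`,
so `s ≤ v_p(ℓ + 1)`, bounded on the finite `S`. [cite: Howard2004HeegnerKolyvagin, §1.6 (arXiv p. 11, L15–16: 𝓛_s ⊂ 𝓛 for s ≫ 0)] -/
theorem exists_forall_not_mem_of_mem_kolyvaginPrimes (hm : 1 ≤ m)
    (T : letI := IwasawaAlgebra.isLocalRing_quotient_X_pow_add_C p hm
      AdicTower K (IwasawaAlgebra p ⧸ Ideal.span {(PowerSeries.X ^ m + PowerSeries.C (p : ℤ_[p]) : IwasawaAlgebra p)}) N)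
    (S : Finset (HeightOneSpectrum (𝓞 K))) :
    letI := IwasawaAlgebra.isLocalRing_quotient_X_pow_add_C p hm
    ∃ s₀ : ℕ, ∀ s, s₀ ≤ s → ∀ v ∈ T.kolyvaginPrimes p s, v ∉ S := by
  refine ⟨S.sup (fun v ↦ padicValNat p (residueChar v + 1)) + 1, fun s hs v hv hvS ↦ ?_⟩
  have h1 : s ≤ padicValNat p (residueChar v + 1) :=
    (padicValNat_dvd_iff_le (Nat.succ_ne_zero _)).mp (pow_dvd_residueChar_add_one_of_mem_kolyvaginPrimes hm T hv)
  have h2 : padicValNat p (residueChar v + 1) ≤ S.sup (fun v ↦ padicValNat p (residueChar v + 1)) :=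
    Finset.le_sup (f := fun v ↦ padicValNat p (residueChar v + 1)) hvS
  omega

end Literature.NumberTheory.GaloisCohomology.Howard2004.AdicTower

namespace WeierstrassCurve

open Literature.NumberTheory.EllipticCurves Literature.NumberTheory.GaloisRepresentations
open Literature.NumberTheory.GaloisRepresentations.DiscreteGaloisModule
open Literature.NumberTheory.GaloisCohomology.Howard2004
open Literature.NumberTheory.EllipticCurves.ZpExtension (EisensteinLevel)

variable {K : Type} [Field K] [NumberField K] (W : WeierstrassCurve ℚ) [W.IsElliptic] {p : ℕ} [hp : Fact p.Prime]
  (κ : ZpExtension K p) {m : ℕ} (hm : 1 ≤ m)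
  (S : Finset (HeightOneSpectrum (𝓞 K)))
  (hpS : ∀ v : HeightOneSpectrum (𝓞 K), ((p : ℕ) : 𝓞 K) ∈ v.asIdeal → v ∈ S)
  (hbad : ∀ v : HeightOneSpectrum (𝓞 K), v ∉ S → ((p : ℕ) : 𝓞 K) ∉ v.asIdeal → (W.baseChange K).HasGoodReductionAt v)
  (L : Set (HeightOneSpectrum (𝓞 K)))
  (hL : letI := IwasawaAlgebra.isLocalRing_quotient_X_pow_add_C p hm
    L ⊆ (W.eisensteinTower κ hm).degreeTwoPrimes p)
  (hLS : ∀ v ∈ L, v ∉ S)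
  (jbar : AlgebraicClosure K →+* ℂ) (cd : ConjugationDatum K)
  (D : letI := IwasawaAlgebra.isLocalRing_quotient_X_pow_add_C p hm
    ∀ k, DualityDatum p cd ((W.eisensteinTower κ hm).ρ k) (IwasawaAlgebra.EisensteinCoeff p m (k + 1)))
  (fs : letI := IwasawaAlgebra.isLocalRing_quotient_X_pow_add_C p hm
    ∀ (k : ℕ) (n : Finset (HeightOneSpectrum (𝓞 K))) (v : HeightOneSpectrum (𝓞 K)),
      galoisCohomology ((W.eisensteinLevelQuot κ hm k n).toLocal (Sum.inr v)) 1 →+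
        SingularQuotient (GaloisRep.toLocal v (W.eisensteinLevelQuot κ hm k n)) ⊗[ℤ] Gell v)

set_option synthInstance.maxHeartbeats 80000 in
/-- **`LargePrimes` for the curve's Eisenstein setting** («`𝓛_s(T) ⊂ 𝓛` for `s ≫ 0`»): it holds as soon as the chosen
`𝓛` contains `𝓛_{s₁}(T) ∖ S` for some `s₁` — since `𝓛_s(T) ⊂ 𝓛_{s₁}(T)` for `s ≥ s₁` and `𝓛_s(T) ∩ S = ∅` for `s ≫ 0`.
[cite: Howard2004HeegnerKolyvagin, §1.6 (arXiv p. 11, L15–16) and Def. 1.2.1] -/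
theorem eisensteinDVRSetting_largePrimes {s₁ : ℕ}
    (hsub : letI := IwasawaAlgebra.isLocalRing_quotient_X_pow_add_C p hm
      ∀ v ∈ (W.eisensteinTower κ hm).kolyvaginPrimes p s₁, v ∉ S → v ∈ L) :
    letI := IwasawaAlgebra.isDomain_quotient_X_pow_add_C p hm
    letI := IwasawaAlgebra.isDiscreteValuationRing_quotient_X_pow_add_C p hm
    haveI := IwasawaAlgebra.EisensteinCoeff.isLocalRing_succ p hm
    letI := IwasawaAlgebra.EisensteinCoeff.algebraOfSpecSucc p m
    haveI := W.isScalarTower_algebraOfSpecSucc (K := K) (p := p) (m := m)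
    letI := W.residueModuleSucc (K := K) (p := p) hm
    (W.eisensteinDVRSetting κ hm S hpS hbad L hL hLS jbar cd D fs).LargePrimes := by
  letI := IwasawaAlgebra.isDomain_quotient_X_pow_add_C p hm
  letI := IwasawaAlgebra.isDiscreteValuationRing_quotient_X_pow_add_C p hm
  haveI := IwasawaAlgebra.EisensteinCoeff.isLocalRing_succ p hm
  letI := IwasawaAlgebra.EisensteinCoeff.algebraOfSpecSucc p m
  haveI := W.isScalarTower_algebraOfSpecSucc (K := K) (p := p) (m := m)
  letI := W.residueModuleSucc (K := K) (p := p) hm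
  obtain ⟨s₂, hs₂⟩ := AdicTower.exists_forall_not_mem_of_mem_kolyvaginPrimes (p := p) hm (W.eisensteinTower κ hm) S
  refine ⟨max s₁ s₂, fun s hs v hv ↦ hsub v ?_ (hs₂ s (le_of_max_le_right hs) v hv)⟩
  exact AdicTower.kolyvaginPrimes_antitone p (W.eisensteinTower κ hm) (le_of_max_le_left hs) hv

end WeierstrassCurve

end
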